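import Mathlib
import HarnessLib
import Summits.NavierStokesRegularity.NavierStokesRegularity.Theorems.UnthreadedDoorNetFluxOneSidedLaw

/-!
# Route `UnthreadedDoor`, crux `PoloidalLiouville` (stmt-NavierStokesRegularity-1222), WALL W1 — netflux line OVER A STRATUM PREDICATE:
# NF-1cᵛ re-run `ExtremalHeadEMFOn S → OneSidedNetFluxLawOn S`

ns-idea-14 g5's second-stratum design (crux idea «height-head», 2026-08-28T23:22Z): the netflux chain is typed ONCE over a stratum predicate
`S : (ℝ → E3 → E3) → E3 → (ℝ → E3 → ℝ) → ℝ → Prop`, replacing the hypothesis «every sphere `S_r(x₀)` is saddle-free for `T(t)`» of the v5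
bodies by «`S v x₀ T t` for every `t` in the window».  In the landed NF-1cᵛ proof (`oneSidedNetFluxLaw_of_extremalHeadEMF`, p673578)
unimodality is used ONLY as the argument handed to hinge (a) (ns-wall-crit-1 g2, 22:48Z), so the same term proves the generic statement:

* `oneSidedNetFluxLawOn_of_extremalHeadEMFOn S` — for EVERY stratum predicate `S`: hinge (a) on the stratum (the body of `ExtremalHeadEMF`
  with the stratum hypothesis) implies the one-sided net-flux law on the stratum (the body of `OneSidedNetFluxLaw` with the stratum
  hypothesis).  Bodies UNFOLDED (the line's `ExtremalHeadEMFOn` / `OneSidedNetFluxLawOn` close by name by definitional unfolding).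

HONEST LABEL: bookkeeping for future strata of W1; nothing about any particular stratum is proved here; `PoloidalLiouville` (1222), C⁻, W1 and
the summit stay OPEN; NO Navier–Stokes regularity statement is proved.  `--supports stmt-NavierStokesRegularity-1222 --as helper`.  [folklore]
-/

noncomputable section

-- the summit and its single sub-problem share the name (CONVENTIONS §1)
set_option linter.dupNamespace false

open Set Function Filter Topology InnerProductSpace MeasureTheory
open scoped RealInnerProductSpace NNReal

namespace Summit.NavierStokesRegularity.NavierStokesRegularity.Theorems.PoloidalLiouville.NetFlux

open Literature.Analysis Literature.Analysis.FluidPDE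

/-- **NF-1cᵛ over a stratum predicate**: for every `S`, hinge (a) on the stratum `S` gives the one-sided net-flux law on the stratum `S`
(same proof as `oneSidedNetFluxLaw_of_extremalHeadEMF`, the stratum hypothesis being passed to hinge (a) only).  No NS statement is
involved. [folklore] -/
theorem oneSidedNetFluxLawOn_of_extremalHeadEMFOn (S : (ℝ → E3 → E3) → E3 → (ℝ → E3 → ℝ) → ℝ → Prop)
    (hA : ∀ (v : ℝ → E3 → E3) (x₀ : E3) (T P : ℝ → E3 → ℝ) (V : ℝ → ℝ) (t₀ : ℝ),
      ContDiffOn ℝ (⊤ : ℕ∞) (uncurry v) (Ioo t₀ 0 ×ˢ univ) →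
      ContDiffOn ℝ (⊤ : ℕ∞) (uncurry T) (Ioo t₀ 0 ×ˢ ({x₀}ᶜ : Set E3)) →
      (∀ t ∈ Ioo t₀ 0, ContDiffOn ℝ 1 (P t) ({x₀}ᶜ : Set E3)) →
      (∀ t ∈ Ioo t₀ 0, ∀ x, ‖v t x‖ ≤ V t) →
      (∀ t ∈ Ioo t₀ 0, ∀ x, x ≠ x₀ →
          cross (gradient (P t) x - (inner ℝ (v t x) (x - x₀)) • gradient (T t) x) (x - x₀) = 0) →
      (∀ t ∈ Ioo t₀ 0, S v x₀ T t) →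
      ∃ I : ℝ → ℝ → ℝ,
        (∀ t ∈ Ioo t₀ 0, ∀ r > 0, ∀ xp ∈ sphArgmax (T t) x₀ r, ∀ xm ∈ sphArgmin (T t) x₀ r,
            I t r = P t xp - P t xm) ∧
        ContinuousOn (uncurry I) (Ioo t₀ 0 ×ˢ Ioi 0) ∧
        (∀ t ∈ Ioo t₀ 0, ∀ a b : ℝ, 0 < a → a < b → ∃ L : NNReal, LipschitzOnWith L (I t) (Icc a b)) ∧
        (∀ t ∈ Ioo t₀ 0, ∀ r > 0, |I t r| ≤ V t * netFlux (T t) x₀ r) ∧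
        (∀ t ∈ Ioo t₀ 0, ∀ᵐ r : ℝ, 0 < r →
            deriv (I t) r ≤ sSup (radDeriv (P t) x₀ '' sphArgmax (T t) x₀ r)
                            - sInf (radDeriv (P t) x₀ '' sphArgmin (T t) x₀ r))) :
    ∀ (v : ℝ → E3 → E3) (x₀ : E3) (T : ℝ → E3 → ℝ) (V : ℝ → ℝ) (t₀ : ℝ),
      ContDiffOn ℝ (⊤ : ℕ∞) (uncurry v) (Ioo t₀ 0 ×ˢ univ) →
      ContDiffOn ℝ (⊤ : ℕ∞) (uncurry T) (Ioo t₀ 0 ×ˢ ({x₀}ᶜ : Set E3)) →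
      (∀ t ∈ Ioo t₀ 0, ∀ x, ‖v t x‖ ≤ V t) →
      CurledLaw v x₀ T (Ioo t₀ 0) →
      (∀ t ∈ Ioo t₀ 0, S v x₀ T t) →
      ∃ ℓp ℓm : ℝ → ℝ → ℝ,
        ContinuousOn (fun p : ℝ × ℝ => netFlux (T p.1) x₀ p.2) (Ioo t₀ 0 ×ˢ Ioi 0) ∧
        (∀ t ∈ Ioo t₀ 0, ∀ r > 0, HasDerivWithinAt (fun ρ => netFlux (T t) x₀ ρ) (ℓp t r) (Ioi r) r) ∧
        (∀ t ∈ Ioo t₀ 0, ∀ r > 0, HasDerivWithinAt (fun ρ => netFlux (T t) x₀ ρ) (ℓm t r) (Iio r) r) ∧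
        (∀ t ∈ Ioo t₀ 0, ∀ a R : ℝ, 0 < a → a < R → ∀ ε > 0, ∃ δ > 0, ∀ h ∈ Ioo 0 δ,
            (∫ r in Ioo a R, netFlux (T t) x₀ r) - (∫ r in Ioo a R, netFlux (T (t - h)) x₀ r)
              ≤ h * (ℓp t R - ℓm t a + V t * (netFlux (T t) x₀ R + netFlux (T t) x₀ a) + ε)) := by
  intro v x₀ T V t₀ hv hT hV hE1 hS
  -- the head potential and the extremal head difference
  obtain ⟨P, hP1, hhead⟩ := exists_headPotential hv hT hE1
  have htan : ∀ t ∈ Ioo t₀ 0, ∀ x, x ≠ x₀ →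
      cross (gradient (P t) x - (inner ℝ (v t x) (x - x₀)) • gradient (T t) x) (x - x₀) = 0 :=
    fun t ht x hx => cross_sub_smul_eq_zero_of_head (hhead t ht x hx)
  obtain ⟨I, -, -, hILip, hIbd, hIderiv⟩ := hA v x₀ T P V t₀ hv hT hP1 hV htan hS
  -- the one-sided derivatives of `w`
  have hex : ∀ t r : ℝ, ∃ lp lm : ℝ, t ∈ Ioo t₀ 0 → 0 < r →
      HasDerivWithinAt (fun ρ => netFlux (T t) x₀ ρ) lp (Ioi r) r ∧
        HasDerivWithinAt (fun ρ => netFlux (T t) x₀ ρ) lm (Iio r) r ∧ lm ≤ lp := by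
    intro t r
    by_cases ht : t ∈ Ioo t₀ 0
    · by_cases hr : 0 < r
      · obtain ⟨lp, lm, hp, hm, hle⟩ := exists_oneSided_deriv_netFlux hT ht hr
        exact ⟨lp, lm, fun _ _ => ⟨hp, hm, hle⟩⟩
      · exact ⟨0, 0, fun _ h => absurd h hr⟩
    · exact ⟨0, 0, fun h _ => absurd h ht⟩
  choose ℓp ℓm hℓ using hex
  refine ⟨ℓp, ℓm, continuousOn_netFlux_family hT.continuousOn, fun t ht r hr => (hℓ t r ht hr).1,
    fun t ht r hr => (hℓ t r ht hr).2.1, fun t ht a R ha haR ε hε => ?_⟩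
  exact oneSidedLaw_core hT hP1 hhead hILip hIbd hIderiv (fun t ht r hr => hℓ t r ht hr) ht ha haR hε

end Summit.NavierStokesRegularity.NavierStokesRegularity.Theorems.PoloidalLiouville.NetFlux

end
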